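import Summits.KontsevichZagierPeriods.KontsevichZagierPeriods.Theorems.RealEllipticSectorKernel.Negative.Core
import Literature.NumberTheory.Transcendental.SemialgebraicMapsProofs

/-!
# `RealEllipticSectorKernel` (stmt-KontsevichZagierPeriods-10632), negative side: the typed ovals are semialgebraic

Support lemmas for the cdisprove findings F9–F10 (`Negative/CMPoint.lean`,
`Negative/TwoTorsionElement.lean`; commentary in `Cruxes/RealEllipticSectorKernel/Disproof.lean`):
the crux's root-free, quantified descriptions of the ovals `σ = (e₃,e₂)` and `σ' = (e₂,e₁)`
(`Negative.σ₁`, `Negative.σ₂`) ARE `ℚ`-semialgebraic uniformly in `q₂ q₃` (projection theorem,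
`IsSemialgebraic.image_comp`), the integrands `1/√(±f)` are `ℚ`-semialgebraic functions on them
(`√` of a rational function).
These are the side conditions of every move on this sector and the data of every honest
representation built downstream.

Sources: M. Kontsevich, D. Zagier, *Periods* (2001), §§1.1–1.2; J. Vélu, *Isogénies entre courbes
elliptiques*, C. R. Acad. Sci. Paris 273 (1971) 238–241; D. Masser, *Elliptic Functions and
Transcendence*, LNM 437 (1975), Ch. III. -/

noncomputable section

namespace Summit.KontsevichZagierPeriods.RealEllipticSectorKernel.Ovals

open MeasureTheory Set
open Literature.NumberTheory.Transcendental Literature.ModelTheory.ExponentialFields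
open Summit.KontsevichZagierPeriods.RealEllipticSectorKernel.Negative

/-! ### Semialgebraicity of the typed ovals (every curve) -/

/-- The cubic as the evaluation of a `ℚ`-polynomial in the `i`-th coordinate. [folklore] -/
theorem aeval_cubicPoly {n : ℕ} (q₂ q₃ : ℚ) (i : Fin n) (w : Fin n → ℝ) :
    MvPolynomial.aeval w (4 * MvPolynomial.X i ^ 3 - MvPolynomial.C q₂ * MvPolynomial.X i -
      MvPolynomial.C q₃ : MvPolynomial (Fin n) ℚ) = cubic q₂ q₃ (w i) := by
  simp [cubic]

/-- `{w | 0 < f (w i)}` is `ℚ`-semialgebraic. [folklore] -/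
theorem isSemialgebraic_cubic_pos {n : ℕ} (q₂ q₃ : ℚ) (i : Fin n) :
    IsSemialgebraic ℚ {w : Fin n → ℝ | 0 < cubic q₂ q₃ (w i)} := by
  convert isSemialgebraic_setOf_eval_pos (k := ℚ) (R := ℝ)
    (4 * MvPolynomial.X i ^ 3 - MvPolynomial.C q₂ * MvPolynomial.X i -
      MvPolynomial.C q₃ : MvPolynomial (Fin n) ℚ) using 1
  ext w
  rw [mem_setOf_eq, mem_setOf_eq, aeval_cubicPoly]

/-- `{w | f (w i) < 0}` is `ℚ`-semialgebraic. [folklore] -/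
theorem isSemialgebraic_cubic_neg {n : ℕ} (q₂ q₃ : ℚ) (i : Fin n) :
    IsSemialgebraic ℚ {w : Fin n → ℝ | cubic q₂ q₃ (w i) < 0} := by
  convert isSemialgebraic_setOf_eval_pos (k := ℚ) (R := ℝ)
    (-(4 * MvPolynomial.X i ^ 3 - MvPolynomial.C q₂ * MvPolynomial.X i -
      MvPolynomial.C q₃) : MvPolynomial (Fin n) ℚ) using 1
  ext w
  rw [mem_setOf_eq, mem_setOf_eq, map_neg, aeval_cubicPoly, neg_pos]

/-- `{w | w i < w j}` is `ℚ`-semialgebraic. [folklore] -/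
theorem isSemialgebraic_lt {n : ℕ} (i j : Fin n) :
    IsSemialgebraic ℚ {w : Fin n → ℝ | w i < w j} := by
  convert isSemialgebraic_setOf_eval_pos (k := ℚ) (R := ℝ)
    (MvPolynomial.X j - MvPolynomial.X i : MvPolynomial (Fin n) ℚ) using 2 with w
  simp [sub_pos]

/-- **`σ = (e₃,e₂)` as typed in the crux is `ℚ`-semialgebraic** (projection of
`{(x,t) | f x > 0, x < t, f t < 0} ⊆ ℝ²`). [folklore] -/
theorem isSemialgebraic_σ₁ (q₂ q₃ : ℚ) : IsSemialgebraic ℚ (σ₁ q₂ q₃) := by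
  have hT : IsSemialgebraic ℚ
      {w : Fin 2 → ℝ | 0 < cubic q₂ q₃ (w 0) ∧ w 0 < w 1 ∧ cubic q₂ q₃ (w 1) < 0} := by
    convert ((isSemialgebraic_cubic_pos q₂ q₃ (0 : Fin 2)).inter (isSemialgebraic_lt (0 : Fin 2) 1)).inter
      (isSemialgebraic_cubic_neg q₂ q₃ (1 : Fin 2)) using 1
    ext w
    simp [and_assoc]
  convert hT.image_comp (fun _ : Fin 1 => (0 : Fin 2)) using 1
  ext p
  simp only [σ₁, mem_setOf_eq, mem_image, Function.comp_def]
  constructor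
  · rintro ⟨hp, t, hpt, ht⟩
    refine ⟨![p 0, t], ⟨by simpa using hp, by simpa using hpt, by simpa using ht⟩, ?_⟩
    funext i
    rw [Fin.fin_one_eq_zero i]
    simp
  · rintro ⟨w, ⟨h0, h01, h1⟩, rfl⟩
    exact ⟨h0, w 1, h01, h1⟩

/-- **`σ' = (e₂,e₁)` as typed in the crux is `ℚ`-semialgebraic.** [folklore] -/
theorem isSemialgebraic_σ₂ (q₂ q₃ : ℚ) : IsSemialgebraic ℚ (σ₂ q₂ q₃) := by
  have hT : IsSemialgebraic ℚ
      {w : Fin 2 → ℝ | cubic q₂ q₃ (w 0) < 0 ∧ w 1 < w 0 ∧ 0 < cubic q₂ q₃ (w 1)} := by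
    convert ((isSemialgebraic_cubic_neg q₂ q₃ (0 : Fin 2)).inter (isSemialgebraic_lt (1 : Fin 2) 0)).inter
      (isSemialgebraic_cubic_pos q₂ q₃ (1 : Fin 2)) using 1
    ext w
    simp [and_assoc]
  convert hT.image_comp (fun _ : Fin 1 => (0 : Fin 2)) using 1
  ext p
  simp only [σ₂, mem_setOf_eq, mem_image, Function.comp_def]
  constructor
  · rintro ⟨hp, t, hpt, ht⟩
    refine ⟨![p 0, t], ⟨by simpa using hp, by simpa using hpt, by simpa using ht⟩, ?_⟩
    funext i
    rw [Fin.fin_one_eq_zero i]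
    simp
  · rintro ⟨w, ⟨h0, h01, h1⟩, rfl⟩
    exact ⟨h0, w 1, h01, h1⟩

/-- `1/√f` is `ℚ`-semialgebraic on the root-free oval `σ` (every curve). [folklore] -/
theorem isSemialgebraicFunOn_inv_sqrt_cubic (q₂ q₃ : ℚ) :
    IsSemialgebraicFunOn ℚ (σ₁ q₂ q₃) (fun p => 1 / Real.sqrt (cubic q₂ q₃ (p 0))) := by
  have hσ := isSemialgebraic_σ₁ q₂ q₃
  set F : MvPolynomial (Fin 1) ℚ := 4 * MvPolynomial.X 0 ^ 3 - MvPolynomial.C q₂ * MvPolynomial.X 0 -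
    MvPolynomial.C q₃ with hF
  have hne : ∀ p ∈ σ₁ q₂ q₃, MvPolynomial.aeval p F ≠ 0 := by
    intro p hp
    rw [hF, aeval_cubicPoly]
    exact hp.1.ne'
  have h1 := isSemialgebraicFunOn_aeval_div_aeval hσ (1 : MvPolynomial (Fin 1) ℚ) F hne
  have h2 : IsSemialgebraicFunOn ℚ (σ₁ q₂ q₃) (fun p => 1 / cubic q₂ q₃ (p 0)) := by
    refine h1.congr (fun p _ => ?_)
    simp only [hF, map_one, aeval_cubicPoly]
  refine (IsSemialgebraicFunOn.sqrt_holds h2).congr (fun p _ => ?_)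
  simp only [one_div, Real.sqrt_inv]

/-- `1/√(−f)` is `ℚ`-semialgebraic on the root-free interval `σ'` (every curve). [folklore] -/
theorem isSemialgebraicFunOn_inv_sqrt_neg_cubic (q₂ q₃ : ℚ) :
    IsSemialgebraicFunOn ℚ (σ₂ q₂ q₃) (fun p => 1 / Real.sqrt (-cubic q₂ q₃ (p 0))) := by
  have hσ := isSemialgebraic_σ₂ q₂ q₃
  set F : MvPolynomial (Fin 1) ℚ := -(4 * MvPolynomial.X 0 ^ 3 - MvPolynomial.C q₂ * MvPolynomial.X 0 -
    MvPolynomial.C q₃) with hF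
  have hne : ∀ p ∈ σ₂ q₂ q₃, MvPolynomial.aeval p F ≠ 0 := by
    intro p hp
    rw [hF, map_neg, aeval_cubicPoly, neg_ne_zero]
    exact hp.1.ne
  have h1 := isSemialgebraicFunOn_aeval_div_aeval hσ (1 : MvPolynomial (Fin 1) ℚ) F hne
  have h2 : IsSemialgebraicFunOn ℚ (σ₂ q₂ q₃) (fun p => 1 / (-cubic q₂ q₃ (p 0))) := by
    refine h1.congr (fun p _ => ?_)
    simp only [hF, map_one, map_neg, aeval_cubicPoly]
  refine (IsSemialgebraicFunOn.sqrt_holds h2).congr (fun p _ => ?_)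
  simp only [one_div, Real.sqrt_inv]

end Summit.KontsevichZagierPeriods.RealEllipticSectorKernel.Ovals

end
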